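import Literature.NumberTheory.LFunctions.RHWave0
import Literature.Barriers.RiemannHypothesis.MollifierLimitations
import HarnessLib

/-!
# Bettin–Chandee–Radziwiłł: the twisted second moment of `ζ` beyond `θ = 1/2` (§1, §2 statements)

Topic `NumberTheory/LFunctions` (mean values of `ζ` times a Dirichlet polynomial; next to
`Conrey1989MeanValue`, `LevinsonMethodPRZZMeanSquare`, and the Balasubramanian–Conrey–Heath-Brown
`θ < 1/2` input `Literature.Barriers.RiemannHypothesis.BalasubramanianConreyHeathBrown1985_meanSquare`).
S. Bettin, V. Chandee, M. Radziwiłł, *The mean square of the product of the Riemann zeta-function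
with Dirichlet polynomials*, J. reine angew. Math. 729 (2017) 51–79 = arXiv:1411.7764
[BettinChandeeRadziwill2017], read on the arXiv text fetched by `lit read arxiv:1411.7764`
(pp. 1–6: §1 Theorems 1–4, Conjecture 1, Corollaries 1–2; §2 Propositions 1–3).  STATEMENTS ONLY
(D-0014/D-0064, one file for the source's §§1–2): objects with bodies, results as named facts
`def … : Prop` with the printed hypotheses, exponents and ranges verbatim; nothing proved here.

What is typed.

* `BettinChandeeRadziwill2017.momentI φ T A` — the weighted twisted second moment (1.1)
  `I = ∫ |ζ(½+it)|² |A(½+it)|² φ(t/T) dt`, `φ` smooth supported in `[1,2]`, for ANY `A : ℂ → ℂ`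
  (the Dirichlet polynomial `A(s) = ∑_{n ≤ N} a_n n^{−s}` is the tree's
  `Literature.Barriers.RiemannHypothesis.dirichletMollifier a N`, reused, not re-declared);
  `mainTerm φ T L a = ∑_{d,e ≤ L} (ā_d a_e/[d,e]) ∫ (log(t(d,e)²/(2πde)) + 2γ) φ(t/T) dt` — the
  printed main term of Theorems 1–4.
* `BettinChandeeRadziwill2017.theorem1` — **Theorem 1**: the asymptotic for ARBITRARY `a_n ≪ n^ε`
  and `θ < 1/2 + 1/66 = 17/33`, error `O(T^{3/20+ε} N^{33/20} + T^{1/3+ε})`, `N = T^θ` (the record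
  "breaking the ½ barrier for an arbitrary Dirichlet polynomial", p. 2).
* `trilinearEstimate r t` — the HYPOTHESIS SCHEMA (1.3) (a general estimate for trilinear forms
  of Kloosterman fractions with parameters `r, t ≥ 0`; NOT asserted: "The estimate of Duke,
  Friedlander, Iwaniec implies (1.3) with `r = 23/48` and `t = 1/2`, while the estimate of Bettin
  and Chandee allows us to take `r = 9/20` and `t = 7/20`. We conjecture that (1.3) holds true for
  all `r, t ≥ 0`." (p. 3); `r = t = 0` is their **Conjecture 1** (1.4), an OPEN conjecture — it is
  only ever used here as an antecedent);
  `theorem2` — **Theorem 2** ((1.3) for some `r,t ≥ 0` ⇒ the asymptotic for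
  `θ < 1/2 + (0.5−r)/(1+2(r+2t))` with error `O(T^{1/2−t+ε} N^{1/2+r+2t} + T^{1/3+ε})`);
  `corollary1` — **Corollary 1** (Conjecture 1 ⇒ the Lindelöf Hypothesis, the tree's open
  `Literature.NumberTheory.LFunctions.LindelofHypothesis`).
* `corollary2` — **Corollary 2**: `∫_T^{2T} |ζ(½+it)|³ dt ≪ T (log T)^{9/4}` (unconditional).
* `theorem3` — **Theorem 3** (§1.1, products `A(s)B(s)` of two Dirichlet polynomials, `N ≥ K`,
  refining Deshouillers–Iwaniec [DI84] to an asymptotic with error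
  `O(T^ε (T^{1/2}N^{3/4}K + T^{1/2}NK^{1/2} + N^{7/4}K^{3/2}))`; "allows us to take `θ < 1/2 + 1/10`").
* `deshouillersIwaniec1984_incompleteKloosterman` — **Proposition 2** (§2, "due to Deshouillers
  and Iwaniec [DI84]" = Acta Arith. 43 (1984) 305–312, as printed in this source): for
  `L, J, U, V ≥ 1`, `|c(u,v)| ≤ 1` and a fixed positive integer `ϱ`,
  `∑_{ℓ≤L} ∑_{j≤J, (ℓ,ϱj)=1} |∑_{u≤U} ∑_{v≤V, (v,ℓ)=1} c(u,v) e(u·(ϱvj)‾/ℓ)|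
   ≪ (LJUV)^{1/2+ε} {(LJ)^{1/2} + (U+V)^{1/4} [LJ(U+ϱV)(L+ϱV²) + ϱUV²J²]^{1/4}}` — a bound for sums
  of incomplete Kloosterman sums whose inverted variable `ϱvj` carries a FIXED factor `ϱ`.

INDEX ONLY (printed, not typed here; type on request): **Theorem 4** (§1.2, `A(s)B(s)` with
`α_n = ψ(n)` smooth of length `N ≪ T^{1/2+ε}`, `β_k ≪ k^ε` of length `K ≪ T^{1/4}`, supports
`[NT^{−ξ₁}, 2N]`, `[KT^{−ξ₂}, 2K]`, `0 ≤ ξ₁ ≤ 1/5`, `0 ≤ ξ₂ ≤ 1/16`: error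
`O(T^{1/2+ε}K² + KN^{3/4}T^{3/8+ε} + T^{39/40+ξ₁/8+2ξ₂/5+ε})`, "allows us to take `θ < 3/4`", p. 5);
**Proposition 1** (= Bettin–Chandee's trilinear bound in the `[M,2M)` box convention — IN THE TREE
as `Literature.NumberTheory.LFunctions.BettinChandee2018_trilinearKloostermanFractions`, cite it);
**Proposition 3** (Watt 1995, Prop. 4.1-derived, p. 6); §6.1 (sharp `2k`-th moment bounds for
`k = 1 + 1/n`).

Rendering decisions (faithfulness notes).

1. *`a_n ≪ n^ε`.*  As for the tree's BCH fact: a family of implied constants `C : ℝ → ℝ` is given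
   and the coefficient class is `∀ δ > 0, ∀ n ≥ 1, |a_n| ≤ C(δ) n^δ`; the implied constants of the
   conclusions may depend on `θ`, `φ`, `C` and `ε` ("`∀ θ φ C ε, ∃ K T₀, ∀ T ≥ T₀, ∀ a`").
2. *The weight.*  `φ : ℝ → ℝ` smooth (`ContDiff ℝ ∞`) with `φ(x) ≠ 0 → x ∈ [1,2]` ("a smooth
   function supported in `[1,2]`", (1.1)); no normalisation is printed and none is added.  The
   integrals are over `ℝ` (Bochner); `log t` only meets `t ∈ [T, 2T]`.
3. *Main term.*  `ā_d a_e/[d,e]` (the complex conjugate on the first factor, as in (1.2) quoted by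
   the tree's `BalasubramanianConreyHeathBrown1985_meanSquare`); `(d,e) = gcd`, `[d,e] = lcm`,
   `γ = Real.eulerMascheroniConstant`.
4. *Theorem 3.*  (1.5) displays `J = ∫ |ζ|²|A|²|B|² dt`; its main term (p. 4) and its proof (§4,
   the factor `φ(xyn₁n₂/T)`, p. 16) carry the weight `φ(t/T)` of (1.1), so `J` is rendered as
   `momentI φ T (A·B)`.  The coefficients of `A·B` are `a_d = ∑_{nk=d} α_n β_k` (`n ≤ N`, `k ≤ K`).
   We add the implicit size restriction `N ≤ T` (lengths are `≪ T` throughout the paper; under it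
   the printed `T^ε` absorbs `N^ε, K^ε`) and flag it here; `1 ≤ K ≤ N` as printed ("`N ≥ K`").
5. *(1.3).*  Boxes `M ≤ m < 2M`, `N ≤ n < 2N`, `A ≤ a < 2A` as printed (p. 2); "`A ≪ (NM)^{c+ε}`" is
   the hypothesis `A ≤ (NM)^{c+ε}` with the SAME `ε` as in the bound and a constant depending on
   `ε`; `‖·‖_∞` is rendered by arbitrary majorants `Bα ≥ |α_m|`, `Bβ ≥ |β_n|` (monotone, hence
   equivalent); `m̄ m ≡ 1 (mod n)` is `((m : ZMod n)⁻¹).val`, `e(x) = exp(2πix)`.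
6. *Proposition 2.*  `ϱ ≥ 1` an integer, uniform ("`≪`" depends on `ε` only, `ϱ` being explicit
   in the bound); `(ϱvj)‾` the inverse modulo `ℓ` (it exists: `(ℓ, ϱj) = (ℓ, v) = 1`).

Bearing (cell landau-siegel, families B-ell / B-len; tags E*-ℓ, E*-len): Theorem 1 is the
in-print record `δ = 1/66` for the twisted second moment with ARBITRARY coefficients (the 2026
claim `δ = 1/46` of arXiv:2601.00292 was WITHDRAWN by its authors, 2026-01-05); Theorem 2 /
Corollary 1 PRICE the lever: any `(r,t)` in (1.3) converts to a length `1/2 + (0.5−r)/(1+2(r+2t))`,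
and square-root cancellation (`r = t = 0`) is Lindelöf-strength.  Proposition 2 is the one printed
Kloosterman-fraction bound in this source whose inverted variable has a fixed factor `ϱ` — the shape
`e(l·(Dk)‾/p)` that Zhang's (14.8) phase `e(−l p̄/(Dk))` takes after reciprocity (ELL-CENSUS v1.0
§3); whether its ranges (`U` = numerator length, `V` = `k`-length, `L` = prime moduli, `ϱ = D`) reach
the (14.8) range is for the B-ell planner/refuter to price, not asserted here.

## References

* S. Bettin, V. Chandee, M. Radziwiłł, *The mean square of the product of the Riemann zeta-function
  with Dirichlet polynomials*, J. reine angew. Math. 729 (2017) 51–79, doi:10.1515/crelle-2014-0133,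
  arXiv:1411.7764: §1 (1.1)–(1.6), Theorems 1–4, Conjecture 1, Corollaries 1–2 (pp. 1–5); §2
  Propositions 1–3 (p. 6). [BettinChandeeRadziwill2017]
* J.-M. Deshouillers, H. Iwaniec, *Power mean-values for Dirichlet's polynomials and the Riemann
  zeta-function, II*, Acta Arith. 43 (1984) 305–312 (source of Proposition 2, cited through
  [BettinChandeeRadziwill2017, Prop. 2]).
* S. Bettin, V. Chandee, *Trilinear forms with Kloosterman fractions*, Adv. Math. 328 (2018)
  (Proposition 1; tree decl `BettinChandee2018_trilinearKloostermanFractions`). [BettinChandee2018]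
* R. Balasubramanian, J. B. Conrey, D. R. Heath-Brown, J. reine angew. Math. 357 (1985) 161–181
  ((1.2), `θ < 1/2`). [BalasubramanianConreyHeathBrown1985]

«The programme SEARCHES and TYPES; no claim about Landau–Siegel zeros, Theorems 1–2 of
arXiv:2211.02515 or a repaired Margin232 until a kernel theorem says so.»
-/

noncomputable section

open scoped ContDiff
open Finset Real Complex MeasureTheory
open Literature.Barriers.RiemannHypothesis (dirichletMollifier)

namespace Literature.NumberTheory.LFunctions

namespace BettinChandeeRadziwill2017

/-! ### §1 objects -/

/-- The weighted twisted second moment (1.1):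
`I = ∫_ℝ |ζ(½+it)|² |A(½+it)|² φ(t/T) dt` for a test function `φ` ("smooth, supported in
`[1,2]`") and any `A : ℂ → ℂ` (in the source `A(s) = ∑_{n ≤ T^θ} a_n n^{−s}`, the tree's
`dirichletMollifier a ⌊T^θ⌋`). [cite: BettinChandeeRadziwill2017, (1.1)] -/
def momentI (φ : ℝ → ℝ) (T : ℝ) (A : ℂ → ℂ) : ℝ :=
  ∫ t : ℝ, ‖riemannZeta (1 / 2 + t * I)‖ ^ 2 * ‖A (1 / 2 + t * I)‖ ^ 2 * φ (t / T)

/-- The printed main term of Theorems 1–4: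
`∑_{d,e ≤ L} (ā_d a_e/[d,e]) · ∫_ℝ (log(t (d,e)²/(2π d e)) + 2γ) φ(t/T) dt`
(`(d,e) = gcd`, `[d,e] = lcm`, `γ` = Euler's constant). [cite: BettinChandeeRadziwill2017, Theorem 1] -/
def mainTerm (φ : ℝ → ℝ) (T : ℝ) (L : ℕ) (a : ℕ → ℂ) : ℂ :=
  ∑ d ∈ Icc 1 L, ∑ e ∈ Icc 1 L,
    (starRingEnd ℂ (a d) * a e / ((Nat.lcm d e : ℕ) : ℂ)) *
      ((∫ t : ℝ, (Real.log (t * ((Nat.gcd d e : ℕ) : ℝ) ^ 2 / (2 * Real.pi * d * e)) +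
          2 * Real.eulerMascheroniConstant) * φ (t / T) : ℝ) : ℂ)

/-- The coefficient class "`a_n ≪ n^ε`" with an explicit family of implied constants `C`:
`|a_n| ≤ C(δ) n^δ` for every `δ > 0` and `n ≥ 1` (the rendering used by the tree's
`Literature.Barriers.RiemannHypothesis.BalasubramanianConreyHeathBrown1985_meanSquare`).
[cite: BettinChandeeRadziwill2017, (1.1)] -/
def InCoeffClass (C : ℝ → ℝ) (a : ℕ → ℂ) : Prop :=
  ∀ δ : ℝ, 0 < δ → ∀ n : ℕ, 1 ≤ n → ‖a n‖ ≤ C δ * (n : ℝ) ^ δ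

/-- The class of test functions of (1.1): `φ` smooth with `φ(x) ≠ 0 → x ∈ [1,2]`.
[cite: BettinChandeeRadziwill2017, (1.1)] -/
def IsTestWeight (φ : ℝ → ℝ) : Prop :=
  ContDiff ℝ ∞ φ ∧ ∀ x : ℝ, φ x ≠ 0 → x ∈ Set.Icc (1 : ℝ) 2

/-! ### §1 Theorem 1 — `θ < 1/2 + 1/66` for arbitrary coefficients -/

/-- **Bettin–Chandee–Radziwiłł 2017, Theorem 1** (p. 2), as printed: "Let `I` and `A(s)` be as
above [`A(s) := ∑_{n ≤ T^θ} a_n n^{−s}`, `a_n ≪ n^ε`]. If `θ < 1/2 + δ`, with `δ = 1/66` then,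
`I = ∑_{d,e ≤ T^θ} (ā_d a_e/[d,e]) · ∫_ℝ (log(t(d,e)²/(2πde)) + 2γ) φ(t/T) dt
     + O(T^{3/20+ε} N^{33/20} + T^{1/3+ε})`, where `N := T^θ`."
(`1/2 + 1/66 = 17/33 = 0.5151…`; "The use of Theorem 2 in [DFI97a] is also enough to break the ½
barrier, though with the smaller constant `δ = 1/190`", ibid.)  Constants may depend on `θ, φ, C, ε`
(module docstring, item 1).  Named fact, not proved here.
[cite: BettinChandeeRadziwill2017, Theorem 1] -/
def theorem1 : Prop :=
  ∀ θ : ℝ, 0 < θ → θ < 1 / 2 + 1 / 66 →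
  ∀ φ : ℝ → ℝ, IsTestWeight φ → ∀ C : ℝ → ℝ, ∀ ε : ℝ, 0 < ε →
    ∃ K T₀ : ℝ, ∀ T : ℝ, T₀ ≤ T → ∀ a : ℕ → ℂ, InCoeffClass C a →
      ‖((momentI φ T (dirichletMollifier a ⌊T ^ θ⌋₊) : ℝ) : ℂ) - mainTerm φ T ⌊T ^ θ⌋₊ a‖ ≤
        K * (T ^ (3 / 20 + ε) * (T ^ θ) ^ (33 / 20 : ℝ) + T ^ (1 / 3 + ε))

/-! ### §1 the hypothesis schema (1.3), Theorem 2, Conjecture 1 ⇒ Lindelöf (Corollary 1) -/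

/-- **The general trilinear estimate (1.3) with parameters `r, t`** (p. 2) — a two-parameter
family of STATEMENTS (a predicate in `(r,t)`, used by the source only as the hypothesis of
Theorem 2; this file asserts no instance of it): "`S_{A,M,N} := ∑_a ∑∑_{(m,n)=1} ν_a α_m β_n e(a m̄/n)
  ≪_ε ‖α‖‖β‖‖ν‖ (M+N)^{1/2+r+ε} A^t + ‖ν‖ A^{1/2} (‖α‖_∞ ‖β‖ N^{1/2+ε} + ‖α‖ ‖β‖_∞ M^{1/2+ε})`,
where `M ≤ m < 2M`, `N ≤ n < 2N`, `A ≤ a < 2A`, `A ≪ (NM)^{(0.5−r)/(1+2t)+ε}`, and `‖·‖` and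
`‖·‖_∞` denote the `L²` and `L^∞` norms respectively."  Which `(r,t)` are theorems is recorded
in print (p. 3): `(23/48, 1/2)` by Duke–Friedlander–Iwaniec, `(9/20, 7/20)` by Bettin–Chandee;
the instance `(0,0)` is the source's statement (1.4), whose status is discussed there and in the
module docstring.  Sup norms are rendered by arbitrary majorants `Bα, Bβ` (module docstring,
item 5). [cite: BettinChandeeRadziwill2017, (1.3)–(1.4)] -/
def trilinearEstimate (r t : ℝ) : Prop :=
  ∀ ε : ℝ, 0 < ε → ∃ K : ℝ, 0 < K ∧
    ∀ (A M N : ℝ), 1 ≤ A → 1 ≤ M → 1 ≤ N →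
      A ≤ (N * M) ^ ((1 / 2 - r) / (1 + 2 * t) + ε) →
    ∀ (α β ν : ℕ → ℂ) (Bα Bβ : ℝ),
      (∀ m : ℕ, α m ≠ 0 → M ≤ m ∧ (m : ℝ) < 2 * M) →
      (∀ n : ℕ, β n ≠ 0 → N ≤ n ∧ (n : ℝ) < 2 * N) →
      (∀ a : ℕ, ν a ≠ 0 → A ≤ a ∧ (a : ℝ) < 2 * A) →
      (∀ m : ℕ, ‖α m‖ ≤ Bα) → (∀ n : ℕ, ‖β n‖ ≤ Bβ) →
      ‖∑ a ∈ Icc 1 ⌊2 * A⌋₊, ∑ m ∈ Icc 1 ⌊2 * M⌋₊, ∑ n ∈ Icc 1 ⌊2 * N⌋₊,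
          if m.Coprime n then
            ν a * α m * β n * Complex.exp (2 * Real.pi * Complex.I *
              ((a : ℂ) * ((((m : ZMod n)⁻¹).val : ℕ) : ℂ) / (n : ℂ)))
          else 0‖ ≤
        K * (Real.sqrt (∑ m ∈ Icc 1 ⌊2 * M⌋₊, ‖α m‖ ^ 2) *
              Real.sqrt (∑ n ∈ Icc 1 ⌊2 * N⌋₊, ‖β n‖ ^ 2) *
              Real.sqrt (∑ a ∈ Icc 1 ⌊2 * A⌋₊, ‖ν a‖ ^ 2) *
              (M + N) ^ (1 / 2 + r + ε) * A ^ t +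
            Real.sqrt (∑ a ∈ Icc 1 ⌊2 * A⌋₊, ‖ν a‖ ^ 2) * A ^ (1 / 2 : ℝ) *
              (Bα * Real.sqrt (∑ n ∈ Icc 1 ⌊2 * N⌋₊, ‖β n‖ ^ 2) * N ^ (1 / 2 + ε) +
                Real.sqrt (∑ m ∈ Icc 1 ⌊2 * M⌋₊, ‖α m‖ ^ 2) * Bβ * M ^ (1 / 2 + ε)))

/-- **Bettin–Chandee–Radziwiłł 2017, Theorem 2** (p. 3), as printed: "Suppose that (1.3) is true
for some `r, t ≥ 0`. Then
`I = ∑_{d,e ≤ T^θ} (ā_d a_e/[d,e]) · ∫_ℝ (log(t(d,e)²/(2πde)) + 2γ) φ(t/T) dt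
     + O(T^{1/2−t+ε} N^{1/2+r+2t} + T^{1/3+ε})`,
for `θ < 1/2 + (0.5−r)/(1+2(r+2t))` and where `N := T^θ`."  Rendered as the implication from the
schema `trilinearEstimate r t`. Named fact, not proved here.
[cite: BettinChandeeRadziwill2017, Theorem 2] -/
def theorem2 : Prop :=
  ∀ r t : ℝ, 0 ≤ r → 0 ≤ t → trilinearEstimate r t →
  ∀ θ : ℝ, 0 < θ → θ < 1 / 2 + (1 / 2 - r) / (1 + 2 * (r + 2 * t)) →
  ∀ φ : ℝ → ℝ, IsTestWeight φ → ∀ C : ℝ → ℝ, ∀ ε : ℝ, 0 < ε →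
    ∃ K T₀ : ℝ, ∀ T : ℝ, T₀ ≤ T → ∀ a : ℕ → ℂ, InCoeffClass C a →
      ‖((momentI φ T (dirichletMollifier a ⌊T ^ θ⌋₊) : ℝ) : ℂ) - mainTerm φ T ⌊T ^ θ⌋₊ a‖ ≤
        K * (T ^ (1 / 2 - t + ε) * (T ^ θ) ^ (1 / 2 + r + 2 * t) + T ^ (1 / 3 + ε))

/-- **Bettin–Chandee–Radziwiłł 2017, Corollary 1** (p. 3): the instance `r = t = 0` of the
estimate (1.3) — the source's statement (1.4), range `A ≪ (NM)^{1/2+ε}` — implies the Lindelöf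
Hypothesis (the tree's `Literature.NumberTheory.LFunctions.LindelofHypothesis`, whose status is
recorded in `RHWave0.lean`).  As printed: "Suppose that [(1.4)] holds. Then the Lindelöf Hypothesis
is true."; and ibid.: "[(1.4)] appears to be strictly stronger than the Lindelöf Hypothesis".  A
published IMPLICATION, vendored as a named fact (not proved here); neither side is asserted.
[cite: BettinChandeeRadziwill2017, Corollary 1] -/
def corollary1 : Prop :=
  trilinearEstimate 0 0 → LindelofHypothesis

/-! ### §1 Corollary 2 — the third moment -/

/-- **Bettin–Chandee–Radziwiłł 2017, Corollary 2** (p. 3), as printed: "We have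
`∫_T^{2T} |ζ(½+it)|³ dt ≪ T (log T)^{9/4}`."  ("Previously Corollary 2 was known only on the
assumption of the Riemann Hypothesis [HB81]", p. 4.)  Rendered with an absolute constant `K` and a
threshold `T₀`.  Named fact, not proved here. [cite: BettinChandeeRadziwill2017, Corollary 2] -/
def corollary2 : Prop :=
  ∃ K T₀ : ℝ, ∀ T : ℝ, T₀ ≤ T →
    (∫ t in T..(2 * T), ‖riemannZeta (1 / 2 + t * I)‖ ^ 3) ≤ K * T * Real.log T ^ (9 / 4 : ℝ)

/-! ### §1.1 Theorem 3 — products of two Dirichlet polynomials -/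

/-- The coefficients of the product `A(s)B(s)`, `A(s) = ∑_{n≤N} α_n n^{−s}`, `B(s) = ∑_{k≤K} β_k k^{−s}`:
`a_d := ∑_{nk = d, n ≤ N, k ≤ K} α_n β_k` (Theorem 3: "with `a_d := ∑_{nk=d} α_n β_k`").
[cite: BettinChandeeRadziwill2017, Theorem 3] -/
def productCoeff (α β : ℕ → ℂ) (N K : ℕ) (d : ℕ) : ℂ :=
  ∑ n ∈ (Nat.divisors d).filter (fun n : ℕ => n ≤ N ∧ d / n ≤ K), α n * β (d / n)

/-- **Bettin–Chandee–Radziwiłł 2017, Theorem 3** (p. 4), as printed: "Let `J`, `A(s)` and `B(s)` be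
as defined in (1.5) and (1.6) [`J = ∫ |ζ(½+it)|²|A(½+it)|²|B(½+it)|²`, `A(s) := ∑_{n≤N} α_n n^{−s}`,
`B(s) := ∑_{k≤K} β_k k^{−s}`, `α_n ≪ n^ε`, `β_k ≪ k^ε`], and let `N ≥ K`. Then,
`J = ∑_{d,e ≤ NK} (ā_d a_e/[d,e]) · ∫_ℝ (log(t(d,e)²/(2πde)) + 2γ) φ(t/T) dt
     + O(T^ε · (T^{1/2}N^{3/4}K + T^{1/2}NK^{1/2} + N^{7/4}K^{3/2}))`,
with `a_d := ∑_{nk=d} α_n β_k`."  ("When the length of `N` and `K` is chosen suitably, Theorem 3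
allows us to take `θ < 1/2 + 1/10`", ibid.; it refines Deshouillers–Iwaniec's bound
`J ≪ T^ε(T + T^{1/2}N^{3/4}K + T^{1/2}NK^{1/2} + N^{7/4}K^{3/2})`.)  `J` carries the weight `φ(t/T)`
and the implicit `N ≤ T` is added (module docstring, item 4).  Named fact, not proved here.
[cite: BettinChandeeRadziwill2017, Theorem 3] -/
def theorem3 : Prop :=
  ∀ φ : ℝ → ℝ, IsTestWeight φ → ∀ Cα Cβ : ℝ → ℝ, ∀ ε : ℝ, 0 < ε →
    ∃ K₀ T₀ : ℝ, ∀ T : ℝ, T₀ ≤ T → ∀ N K : ℝ, 1 ≤ K → K ≤ N → N ≤ T →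
    ∀ α β : ℕ → ℂ, InCoeffClass Cα α → InCoeffClass Cβ β →
      ‖((momentI φ T (fun s => dirichletMollifier α ⌊N⌋₊ s * dirichletMollifier β ⌊K⌋₊ s) : ℝ) : ℂ)
          - mainTerm φ T (⌊N⌋₊ * ⌊K⌋₊) (productCoeff α β ⌊N⌋₊ ⌊K⌋₊)‖ ≤
        K₀ * T ^ ε * (T ^ (1 / 2 : ℝ) * N ^ (3 / 4 : ℝ) * K + T ^ (1 / 2 : ℝ) * N * K ^ (1 / 2 : ℝ)
          + N ^ (7 / 4 : ℝ) * K ^ (3 / 2 : ℝ))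

/-! ### §2 Proposition 2 — Deshouillers–Iwaniec's bound for sums of incomplete Kloosterman sums -/

/-- **Bettin–Chandee–Radziwiłł 2017, Proposition 2 (Deshouillers–Iwaniec, Acta Arith. 43 (1984))**
(p. 6), as printed: "Let `L, J, U, V ≥ 1` and `|c(u,v)| ≤ 1`. We then have
`∑_{1≤ℓ≤L} ∑_{1≤j≤J, (ℓ,ϱj)=1} | ∑_{1≤u≤U} ∑_{1≤v≤V, (v,ℓ)=1} c(u,v) e(u (ϱvj)‾/ℓ) |
   ≪ (LJUV)^{1/2+ε} { (LJ)^{1/2} + (U+V)^{1/4} [ LJ(U+ϱV)(L+ϱV²) + ϱUV²J² ]^{1/4} }`."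
Here `ϱ ≥ 1` is a fixed integer, `(ϱvj)‾` the inverse of `ϱvj` modulo `ℓ`, `e(x) = exp(2πix)`;
the implied constant depends on `ε` only (module docstring, item 6).  Named fact, not proved here.
[cite: BettinChandeeRadziwill2017, Proposition 2] -/
def deshouillersIwaniec1984_incompleteKloosterman : Prop :=
  ∀ ε : ℝ, 0 < ε → ∃ K : ℝ, 0 < K ∧
    ∀ (ϱ : ℕ), 1 ≤ ϱ → ∀ (L J U V : ℝ), 1 ≤ L → 1 ≤ J → 1 ≤ U → 1 ≤ V →
    ∀ c : ℕ → ℕ → ℂ, (∀ u v : ℕ, ‖c u v‖ ≤ 1) →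
      (∑ ℓ ∈ Icc 1 ⌊L⌋₊, ∑ j ∈ Icc 1 ⌊J⌋₊,
          if ℓ.Coprime (ϱ * j) then
            ‖∑ u ∈ Icc 1 ⌊U⌋₊, ∑ v ∈ Icc 1 ⌊V⌋₊,
                if v.Coprime ℓ then
                  c u v * Complex.exp (2 * Real.pi * Complex.I *
                    ((u : ℂ) * (((((ϱ * v * j : ℕ) : ZMod ℓ)⁻¹).val : ℕ) : ℂ) / (ℓ : ℂ)))
                else 0‖
          else 0) ≤
        K * (L * J * U * V) ^ (1 / 2 + ε) *
          ((L * J) ^ (1 / 2 : ℝ) +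
            (U + V) ^ (1 / 4 : ℝ) *
              (L * J * (U + ϱ * V) * (L + ϱ * V ^ 2) + ϱ * U * V ^ 2 * J ^ 2) ^ (1 / 4 : ℝ))

end BettinChandeeRadziwill2017

end Literature.NumberTheory.LFunctions

end
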